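import Summits.Ventures.HSemireg.WeilFrameRealCarrierDegrees
import Summits.Ventures.HSemireg.Mod4LeadingTermPinsNearSelfDual

/-!
# Venture HSemireg — TABLE R's `ch(O_Z)`-SHAPE ROWS ON THE REAL CARRIER AT THE PIN NEXT TO THE SELF-DUAL ONE, every EVEN `n = 2c+2`:
# `dim S_n(x) + 2(n+1) + 2 = (n+3)·C(2n,n)` if `C(n+1,c+1)·q_n·q_{n+2} = C(n,c+1)·q_{n+1}²`, and `… + 1 = …` otherwise

HONEST FRAMING. Part of the Lean index of the computation cell `pub-hsemireg` (seat w3-mod4-1 gen 14, W3 SPECIAL FIBRES;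
MOD4-OFFSPLIT §13.26 (c) ∕ §13.30). The tree's real carriers and the Literature's Weil-type layer ONLY: no semiregularity map, no Ext
group, no `∫`; nothing here says that HC / HC_CM / HC_AV holds; nothing here is a claim about any explicit variety or cycle; no
Literature fact is declared; NO definition is introduced. Imports: FILE 13 `WeilFrameRealCarrierDegrees` (built) + the pure matrix file
`Mod4LeadingTermPinsNearSelfDual`.

WHAT IS PROVED, for `A : AbelianVariety ℂ` of dimension `2n`, `n = c + c + 2`, with the Weil-type hypotheses of `finrank_S_weilType_middle`,
the class `x = Σ_{m ≤ 2n} (q_m/m!) ĥ^m + ĉ₊ + ĉ₋` with `q_m = 0` (`m < n`), `q_n ≠ 0`, ANY tail, and the pin `(2n)!·(ĉ₊ĉ₋) = t·ĥ^{2n}` with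
`t = (−1)ⁿ C(n,c)² q_n²` (the pin next to the self-dual one):
* **`finrank_S_leading_middle_nearSelfDual_of_eq`** — `C(n+1,c+1) q_n q_{n+2} = C(n,c+1) q_{n+1}²` ⇒ `dim S_n(x) + 2(n+1) + 2 = (n+3)·C(2n,n)`;
* **`finrank_S_leading_middle_nearSelfDual_of_ne`** — otherwise `dim S_n(x) + 2(n+1) + 1 = (n+3)·C(2n,n)`
(`r_n = n + 1` by `Mod4LeadingTermMiddle`; the kernel dimension `2 ∕ 1` by `Mod4LeadingTermPinsNearSelfDual`). READING: `n = 2`: `22 ∕ 23` at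
`q₂²` by `3q₂q₄ = 2q₃²`; `n = 4`: `478 ∕ 479` at `16q₄²` by `5q₄q₆ = 3q₅²`; `n = 6`: `8300 ∕ 8301` at `400q₆²` by `7q₆q₈ = 4q₇²`
(`9·924 − 14 = 8302` generic). Everything PROVED, 0 sorry.
References: [BuchweitzFlenner2008HH] Prop. 6.4.4; [vanGeemen1994HodgeAV] 4.9, Lemma 5.2; [BourbakiAlgebre1a3] Ch. III §8, §11 no. 9.
-/

noncomputable section

open CliffordAlgebra (contractLeft)
open ExteriorAlgebra (ι)
open Module CategoryTheory
open Literature.AlgebraicGeometry.Motives Literature.AlgebraicGeometry.HodgeTheory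
open Literature.AlgebraicTopology.SingularHomology

namespace Summit.Ventures.HSemireg.WeilFrame

open Summit.Ventures.HSemireg.WedgeBridge Summit.Ventures.HSemireg.WeilCarrier Summit.Ventures.HSemireg.Mod4Carrier
open Summit.Ventures.HSemireg.Wedge.Hankel

section RealCarrier

variable {A : AbelianVariety ℂ}

/-- **near-self-dual pin, DEGENERATE tail, on the real carrier** (even `n = c + c + 2`, `t = (−1)ⁿ C(n,c)² q_n²`,
`C(n+1,c+1) q_n q_{n+2} = C(n,c+1) q_{n+1}²`): `dim S_n(x) + 2(n+1) + 2 = (n+3)·C(2n,n)`.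
[cite: BuchweitzFlenner2008HH, Prop. 6.4.4] [cite: vanGeemen1994HodgeAV, 4.9 and Lemma 5.2] -/
theorem finrank_S_leading_middle_nearSelfDual_of_eq (hA : IsSmoothProjective A.dim A.X) {n c d : ℕ} (hn : n = c + c + 2) (hdim : A.dim = n + n) (hd : 0 < d)
    {φ : A ⟶ A} (hφ : φ ≫ φ = -(d • 𝟙 A)) {P Q : Submodule ℂ (complexBetti A.X 1)}
    (hP : P = Module.End.eigenspace (complexBetti.map φ.hom.hom.hom 1).hom (Complex.I * (Real.sqrt d : ℂ)))
    (hQ : Q = Module.End.eigenspace (complexBetti.map φ.hom.hom.hom 1).hom (-(Complex.I * (Real.sqrt d : ℂ))))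
    (hp : finrank ℂ ↥(P ⊓ hodgeOneZero hA) = n) {h : complexBetti A.X 2}
    (hh : complexBetti.map φ.hom.hom.hom 2 h = (d : ℂ) • h) (h11 : IsOfHodgeType A.dim A.X 2 1 1 h)
    (hvol : ((⋀[ℂ]^2 (complexBetti A.X 1)).subtype ((abelianVarietyCohomologyExteriorH1_holds.equiv A 2).symm h)) ^ (n + n) ≠ 0)
    {cP cQ : complexBetti A.X (2 * n)} (hcP : cP ∈ weilClassesPlus A φ n d) (hcP0 : cP ≠ 0)
    (hcQ : cQ ∈ weilClassesMinus A φ n d) (hcQ0 : cQ ≠ 0)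
    {q : ℕ → ℂ} (hq0 : ∀ m, m < n → q m = 0) (hqn : q n ≠ 0) {t : ℂ}
    (ht : (((n + n).factorial : ℕ) : ℂ) •
        ((⋀[ℂ]^(2 * n) (complexBetti A.X 1)).subtype ((abelianVarietyCohomologyExteriorH1_holds.equiv A (2 * n)).symm cP) *
          (⋀[ℂ]^(2 * n) (complexBetti A.X 1)).subtype ((abelianVarietyCohomologyExteriorH1_holds.equiv A (2 * n)).symm cQ)) =
      t • ((⋀[ℂ]^2 (complexBetti A.X 1)).subtype ((abelianVarietyCohomologyExteriorH1_holds.equiv A 2).symm h)) ^ (n + n))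
    (hpin : t = (-1 : ℂ) ^ n * ((n.choose c : ℂ) * (n.choose c : ℂ)) * (q n * q n))
    (hdeg : ((n + 1).choose (c + 1) : ℂ) * q n * q (n + 2) = (n.choose (c + 1) : ℂ) * (q (n + 1) * q (n + 1))) :
    finrank ℂ ↥(S ℂ (hodgeZeroOne hA) n
        ((∑ m ∈ Finset.range (n + n + 1), (q m * ((m.factorial : ℕ) : ℂ)⁻¹) •
            ((⋀[ℂ]^2 (complexBetti A.X 1)).subtype ((abelianVarietyCohomologyExteriorH1_holds.equiv A 2).symm h)) ^ m) +
          (⋀[ℂ]^(2 * n) (complexBetti A.X 1)).subtype ((abelianVarietyCohomologyExteriorH1_holds.equiv A (2 * n)).symm cP) +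
          (⋀[ℂ]^(2 * n) (complexBetti A.X 1)).subtype ((abelianVarietyCohomologyExteriorH1_holds.equiv A (2 * n)).symm cQ))) +
        2 * (n + 1) + 2 = (n + 3) * (n + n).choose n := by
  haveI : Module.Finite ℂ (complexBetti A.X 1) := abelianVarietyCohomologyExteriorH1_holds.finite_one A
  have h := finrank_S_weilType_middle hA hdim hd hφ hP hQ hp hh h11 hvol hcP hcP0 hcQ hcQ0 (by omega) q ht
  rw [Mod4.hankel1_rank_leading_middle hq0 hqn, Mod4.finrank_ker_middleM_leading_pin_nearSelfDual_of_eq hn hq0 hqn hpin hdeg] at h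
  have e : (n + 1 + 2) * (n + n).choose n = (n + 3) * (n + n).choose n := by ring
  omega

/-- **near-self-dual pin, GENERIC tail, on the real carrier** (even `n = c + c + 2`, `t = (−1)ⁿ C(n,c)² q_n²`,
`C(n+1,c+1) q_n q_{n+2} ≠ C(n,c+1) q_{n+1}²`): `dim S_n(x) + 2(n+1) + 1 = (n+3)·C(2n,n)`.
[cite: BuchweitzFlenner2008HH, Prop. 6.4.4] [cite: vanGeemen1994HodgeAV, 4.9 and Lemma 5.2] -/
theorem finrank_S_leading_middle_nearSelfDual_of_ne (hA : IsSmoothProjective A.dim A.X) {n c d : ℕ} (hn : n = c + c + 2) (hdim : A.dim = n + n) (hd : 0 < d)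
    {φ : A ⟶ A} (hφ : φ ≫ φ = -(d • 𝟙 A)) {P Q : Submodule ℂ (complexBetti A.X 1)}
    (hP : P = Module.End.eigenspace (complexBetti.map φ.hom.hom.hom 1).hom (Complex.I * (Real.sqrt d : ℂ)))
    (hQ : Q = Module.End.eigenspace (complexBetti.map φ.hom.hom.hom 1).hom (-(Complex.I * (Real.sqrt d : ℂ))))
    (hp : finrank ℂ ↥(P ⊓ hodgeOneZero hA) = n) {h : complexBetti A.X 2}
    (hh : complexBetti.map φ.hom.hom.hom 2 h = (d : ℂ) • h) (h11 : IsOfHodgeType A.dim A.X 2 1 1 h)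
    (hvol : ((⋀[ℂ]^2 (complexBetti A.X 1)).subtype ((abelianVarietyCohomologyExteriorH1_holds.equiv A 2).symm h)) ^ (n + n) ≠ 0)
    {cP cQ : complexBetti A.X (2 * n)} (hcP : cP ∈ weilClassesPlus A φ n d) (hcP0 : cP ≠ 0)
    (hcQ : cQ ∈ weilClassesMinus A φ n d) (hcQ0 : cQ ≠ 0)
    {q : ℕ → ℂ} (hq0 : ∀ m, m < n → q m = 0) (hqn : q n ≠ 0) {t : ℂ}
    (ht : (((n + n).factorial : ℕ) : ℂ) •
        ((⋀[ℂ]^(2 * n) (complexBetti A.X 1)).subtype ((abelianVarietyCohomologyExteriorH1_holds.equiv A (2 * n)).symm cP) *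
          (⋀[ℂ]^(2 * n) (complexBetti A.X 1)).subtype ((abelianVarietyCohomologyExteriorH1_holds.equiv A (2 * n)).symm cQ)) =
      t • ((⋀[ℂ]^2 (complexBetti A.X 1)).subtype ((abelianVarietyCohomologyExteriorH1_holds.equiv A 2).symm h)) ^ (n + n))
    (hpin : t = (-1 : ℂ) ^ n * ((n.choose c : ℂ) * (n.choose c : ℂ)) * (q n * q n))
    (hnd : ((n + 1).choose (c + 1) : ℂ) * q n * q (n + 2) ≠ (n.choose (c + 1) : ℂ) * (q (n + 1) * q (n + 1))) :
    finrank ℂ ↥(S ℂ (hodgeZeroOne hA) n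
        ((∑ m ∈ Finset.range (n + n + 1), (q m * ((m.factorial : ℕ) : ℂ)⁻¹) •
            ((⋀[ℂ]^2 (complexBetti A.X 1)).subtype ((abelianVarietyCohomologyExteriorH1_holds.equiv A 2).symm h)) ^ m) +
          (⋀[ℂ]^(2 * n) (complexBetti A.X 1)).subtype ((abelianVarietyCohomologyExteriorH1_holds.equiv A (2 * n)).symm cP) +
          (⋀[ℂ]^(2 * n) (complexBetti A.X 1)).subtype ((abelianVarietyCohomologyExteriorH1_holds.equiv A (2 * n)).symm cQ))) +
        2 * (n + 1) + 1 = (n + 3) * (n + n).choose n := by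
  haveI : Module.Finite ℂ (complexBetti A.X 1) := abelianVarietyCohomologyExteriorH1_holds.finite_one A
  have h := finrank_S_weilType_middle hA hdim hd hφ hP hQ hp hh h11 hvol hcP hcP0 hcQ hcQ0 (by omega) q ht
  rw [Mod4.hankel1_rank_leading_middle hq0 hqn, Mod4.finrank_ker_middleM_leading_pin_nearSelfDual_of_ne hn hq0 hqn hpin hnd] at h
  have e : (n + 1 + 2) * (n + n).choose n = (n + 3) * (n + n).choose n := by ring
  omega

end RealCarrier

end Summit.Ventures.HSemireg.WeilFrame

end
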